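import Summits.QuantumFields.BalabanUV.Beta.NVertexColumnK1RowPeriodised
import Summits.QuantumFields.BalabanUV.Beta.NVertexSectorsPeriodised
import Summits.QuantumFields.BalabanUV.Beta.BorderedHessianKernelAction

/-!
# `BalabanUV.Beta.NVertexColumnK1RowTorus` — row D1 ∕ (C1) OWNER an2 (gen 63), PART 24: **THE END WRAPPER's (K1) LEFT SIDE ON THE TORUS COLUMN OF THE COMPOSITE
# CHART IS THE FINE-BOND PERIODISATION OF `E″ colN`** — for every torus `T` with `Lc^(j+1) ∣ T i`, every root `ρ`, every source `(μ, y)` and every torus bond `u`: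
# `Σ_b (perF T (bhKStepAt 3 ρ Lc 0))|ff (u, b) · (perF T (AN R j)) (b, (wrapPt T (L•y), inr μ)) = Σ'_n (E″ colN)(u.2, translate T u.1 n)`,
# hence (PART 23) `= −(Lc⁴)^{j+1}·Σ_{κ₁} Σ'_{s₁} (Σ'_n λ′ᴿ_j (κ₁, translate T′ s₁ n))·symLinKerAt (toSite R.r) Lc κ₁ s₁ (u.2, u.1)` for `T = Lc·T′`
# — the wrapper's (K1) row, BOTH SIDES, for the direction `hb (n+1) := colN̂` (road FP g40's word l.67451: «(α) the periodisation of both sides — THE ROW's, GO»)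

HONEST FRAMING (cell charter, verbatim): «discharging `BetaPertH` makes Bałaban's UV stability UNCONDITIONAL — a real constructive-QFT result; it
is NOT the continuum limit and NOT the Clay problem.»  THIS MODULE DISCHARGES NOTHING of `BetaPertH` ∕ row D1 and NOT the END wrapper's (K1) as displayed: there the
direction is `hb (n+1) v = hv v` (the one-shot column PLUS its exact part `tgrad·λ̂θ`, R-FP-79) and the weights carry the road's scalars `c n ∕ w n (n+1)` and data
`cf ∕ hb` — (β)∕(γ) of the road's list (l.67451), successor g41's instantiation.  [folklore] bookkeeping BY NAME over the cell's OWN objects: road FP's periodisation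
`FP/KernelPeriodisationFib.perF ∕ perZ ∕ perF_comp` (PART B, p≈20-08), an2's `BorderedHessian.bhK ∕ bhKAt ∕ bhKStepAt` with the action lemma
`BorderedHessianKernelAction.tsum_bhK_inl_inl` and decay `decays_bhK`, `NVertexSectorsPeriodised.AN_translate_invariant`, lit `KernelSpecInstance.opEL_shift`,
GAN24 `KernelPeriodisation.translate_wrap_quo`, PART 23.  0 `def`, 0 `def … : Prop`, 0 sorry, nothing cited; no table VALUE, no estimate.  NOT (C1), NOT the wrapper's (K1),
NOT D1, NEVER «G-an2-4 closed», NOT BetaPertH, NOT continuum, NOT Clay.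

WHAT (all [folklore]; `L = Lc^(j+1)`, `R : Roots Lc`, `j : ℕ`; `T : Fin 4 → ℕ` a torus with `L ∣ T i`; `colN := colH (AN R j) L μ y`):
* §1 `perF_inl_inl_bhKStepAt_zero_eq` (the periodised ff block of `bhKStepAt 3 ρ Lc 0` is that of the root-free field part of `bhK Lc`), `perF_inl_inr_ffPart_eq_zero`,
  `decays_ffPart_bhK` (the field part decays), `comp_ffPart_bhK_inl_inr` (`(E_ff ∘ A) x z (inl κ) (inr μ) = (E″ (fcol A z (inr μ)))_κ(x)` — `tsum_bhK_inl_inl`).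
* §2 `translate_wrap_eq`, `fcol_AN_translate` (the column sourced at a `T`-translate of the slot's site is the `T`-shifted column — `AN_translate_invariant`),
  `curvAdj_curv_fcol_AN_translate` (lit `opEL_shift`).
* §3 **`perF_ff_mulVec_perF_AN_eq_tsum`** (the identity of the title), **`perF_ff_mulVec_perF_AN_eq_K1_shape`** (with PART 23: the wrapper's (K1) row, both sides,
  for the torus column), `…_tower` (on `towerTorus Lc (fine Lc M) m′` ∕ `towerTorus Lc M m′`, the divisibility displayed as `hT`), `pow_dvd_towerTorus_fine` (its discharge at `j = m′`;
  the `fine` instance of road FP's `KernelPeriodisationFibHessKerTower.pow_succ_dvd_towerTorus`, cf. PART 11 `dvd_towerTorus_fine` at `m′ ≥ 1`).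

HONEST DEPENDENCY (verbatim): «continuum YM on T⁴ ⇐ BetaPertH ∧ nine spine estimates (0/9 proved); BetaPertH ⇐ (D1) ∧ (D4) ∧ CAP+tail;
G-an2-4 gates asym, D1 and NE2/3/4.»  ABSOLUTE RULE (cell, verbatim): «No internally-minted statement may enter as a cited fact. Every
hypothesis is either kernel-proved in this package or a verbatim quotation of a PUBLISHED theorem with page reference.»
Unit `b2b-balaban-beta-an2` gen 63 (row-D1 owner), 2026-08-27; `bears_on: R4-O/T1|T1a` (a (C1)-side identity behind the displayed row (K1); moves no node counter).
No existing file touched.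
-/

noncomputable section

open scoped BigOperators

namespace Summit.QuantumFields.BalabanUV.Beta.NVertexColumnK1RowTorus

open Finset
open Literature.MathematicalPhysics.QuantumFieldTheory
open Literature.MathematicalPhysics.QuantumFieldTheory.Balaban1983to89
open Literature.MathematicalPhysics.QuantumFieldTheory.Balaban1983to89.Beta
open B4TorusKernel.MultiPeriod (translate)
open B4Reflection242 (translate_translate)
open B5Prop11Plancherel (fine)
open B6Lemma24Torus (pbox wrap)
open AffineAveraging (Form1 Site box toSite curv curvAdj)
open ExpKernelCalculus (MKer Decays comp)
open OneStepResolventKernel (Fib KInv)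
open OneStepKernelFamily (colH)
open BalabanStepJets (lamCoeffOf)
open KernelSpecInstance (opEL_shift)
open Summit.QuantumFields.BalabanUV.Beta.AxialDressingRooted (one_le_of_neZero)
open Summit.QuantumFields.BalabanUV.Beta.SymAveragingHessianCounts (symLinKerAt)
open Summit.QuantumFields.BalabanUV.Beta.CompositeVertexKernelRec (compLinKer)
open Summit.QuantumFields.BalabanUV.Beta.CompositeOneShotJetData (Roots AN)
open Summit.QuantumFields.BalabanUV.Beta.NVertexSectors (decays_AN)
open Summit.QuantumFields.BalabanUV.Beta.NVertexSectorsPeriodised (AN_translate_invariant)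
open Summit.QuantumFields.BalabanUV.Beta.BorderedHessian (bhK bhKAt bhKStepAt bhKStepAt_zero bhKAt_inl_inl decays_bhK fcol tsum_bhK_inl_inl)
open Summit.QuantumFields.BalabanUV.Beta.FP.KernelPeriodisationFib (Idx perF perZ perF_apply perZ_apply perF_comp)
open Summit.QuantumFields.BalabanUV.Beta.FP.TorusCompositeObjects (towerTorus towerTorus_apply)
open Summit.QuantumFields.BalabanUV.Beta.FP.TorusGaugeCovariancePairing (wrapPt wrapPt_coe)
open Summit.QuantumFields.BalabanUV.Beta.GAN24.KernelPeriodisation (quo translate_wrap_quo)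
open Summit.QuantumFields.BalabanUV.Beta.NVertexLamCorePeriodised (towerTorus_fine_apply_eq)
open Summit.QuantumFields.BalabanUV.Beta.NVertexColumnK1RowPeriodised (tsum_curvAdj_curv_colH_AN_translate)

variable {Lc : ℕ} [NeZero Lc] (R : Roots Lc) (j : ℕ)

/-! ## §1 The field part of the step-0 bordered Hessian: periodised ff block, decay, action on a column -/

section FieldPart

/-- [folklore] the periodised ff block of `bhKStepAt 3 ρ Lc 0` is that of the ROOT-FREE field part of `bhK Lc` (the window matrix of `d*d`; `bhKAt_inl_inl`). -/
theorem perF_inl_inl_bhKStepAt_zero_eq (ρ : Fin (3 + 1) → ℤ) (T : Fin (3 + 1) → ℕ) (u b : ↥(pbox T) × Fin (3 + 1)) :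
    perF T (bhKStepAt 3 ρ Lc 0) (u.1, Sum.inl u.2) (b.1, Sum.inl b.2)
      = perF T (fun x z (a c : Fib 3) => match a, c with
          | Sum.inl κ, Sum.inl l => bhK Lc x z (Sum.inl κ) (Sum.inl l)
          | _, _ => (0 : ℝ)) (u.1, Sum.inl u.2) (b.1, Sum.inl b.2) := by
  simp only [perF_apply, perZ_apply, bhKStepAt_zero, bhKAt_inl_inl]

omit [NeZero Lc] in
/-- [folklore] the field part has no field–multiplier column: its periodised `(inl, inr)` entries vanish. -/
theorem perF_inl_inr_ffPart_eq_zero (T : Fin (3 + 1) → ℕ) (u : ↥(pbox T) × Fin (3 + 1)) (x : ↥(pbox T)) (m : Fin (3 + 1)) :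
    perF T (fun x z (a c : Fib 3) => match a, c with
          | Sum.inl κ, Sum.inl l => bhK Lc x z (Sum.inl κ) (Sum.inl l)
          | _, _ => (0 : ℝ)) (u.1, Sum.inl u.2) (x, Sum.inr m) = 0 := by
  simp only [perF_apply, perZ_apply, tsum_zero]

/-- [folklore] the field part of `bhK Lc` decays (with `decays_bhK`'s constants at rate `1`): it is `bhK Lc` on the ff block and `0` elsewhere. -/
theorem decays_ffPart_bhK :
    Decays (fun x z (a c : Fib 3) => match a, c with
          | Sum.inl κ, Sum.inl l => bhK Lc x z (Sum.inl κ) (Sum.inl l)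
          | _, _ => (0 : ℝ))
      (BorderedHessian.cBH 3 Lc * Real.exp (1 * (((3 : ℝ) + 1) * (2 * Lc)))) 1 := by
  have h := decays_bhK (d := 3) (N := Lc) (one_le_of_neZero Lc) zero_le_one
  intro x z a c
  rcases a with κ | m <;> rcases c with l | m'
  · exact h x z (Sum.inl κ) (Sum.inl l)
  all_goals
    simp only [abs_zero]
    exact mul_nonneg (mul_nonneg (BorderedHessian.cBH_nonneg 3 Lc) (Real.exp_pos _).le) (Real.exp_pos _).le

omit [NeZero Lc] in
/-- [folklore] **the field part acts on a kernel's column as `E″(1)`**: `(E_ff ∘ A) x z (inl κ) (inr μ) = (d*d (fcol A z (inr μ)))_κ(x)` (`tsum_bhK_inl_inl`; the `inr`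
summands of the middle index vanish). -/
theorem comp_ffPart_bhK_inl_inr (A : MKer (3 + 1) (Fib 3)) (x z : Site (3 + 1)) (κ μ : Fin (3 + 1)) :
    comp (fun x z (a c : Fib 3) => match a, c with
          | Sum.inl κ, Sum.inl l => bhK Lc x z (Sum.inl κ) (Sum.inl l)
          | _, _ => (0 : ℝ)) A x z (Sum.inl κ) (Sum.inr μ)
      = curvAdj (curv (fcol A z (Sum.inr μ))) κ x := by
  unfold ExpKernelCalculus.comp
  rw [← tsum_bhK_inl_inl Lc A x z κ (Sum.inr μ)]
  refine tsum_congr fun y' => ?_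
  rw [Fintype.sum_sum_type]
  simp only [zero_mul, Finset.sum_const_zero, add_zero]

end FieldPart

/-! ## §2 The column sourced at a period-translate of the slot is the shifted column -/

section Shift

/-- [folklore] `translate T (wrap T z) m = translate T z (m − quo T z)` (GAN24 `translate_wrap_quo` + lit `translate_translate`). -/
theorem translate_wrap_eq (T : Fin (3 + 1) → ℕ) (z m : Site (3 + 1)) : translate T (wrap T z) m = translate T z (m - quo T z) := by
  have h := translate_translate T (wrap T z) (quo T z) (m - quo T z)
  rw [translate_wrap_quo, show quo T z + (m - quo T z) = m by abel] at h
  exact h.symm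

/-- [folklore] **the column sourced at the slot `L•(y) + T•n` is the `T•n`-shifted column** (`Lc^(j+1) ∣ T i`: the chart's period invariance `AN_translate_invariant`):
`colH (AN R j) L μ y′` at `L•y′ = translate T (L•y) n` equals `(l, x) ↦ colH (AN R j) L μ y l (x − T•n)`. -/
theorem fcol_AN_translate (T : Fin (3 + 1) → ℕ) (hT : ∀ i, Lc ^ (j + 1) ∣ T i) (μ : Fin (3 + 1)) (y n : Site (3 + 1)) :
    fcol (AN R j) (translate T (((Lc ^ (j + 1) : ℕ) : ℤ) • y) n) (Sum.inr μ)
      = fun l x => colH (AN R j) (Lc ^ (j + 1)) μ y l (x - translate T 0 n) := by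
  funext l x
  show AN R j x (translate T (((Lc ^ (j + 1) : ℕ) : ℤ) • y) n) (Sum.inl l) (Sum.inr μ)
    = AN R j (x - translate T 0 n) (((Lc ^ (j + 1) : ℕ) : ℤ) • y) (Sum.inl l) (Sum.inr μ)
  rw [← AN_translate_invariant R j (M := T) hT n (x - translate T 0 n) (((Lc ^ (j + 1) : ℕ) : ℤ) • y)]
  congr 1
  funext i; simp only [B4TorusKernel.MultiPeriod.translate_apply, Pi.sub_apply, Pi.zero_apply]; ring

/-- [folklore] … hence its Hessian image is the shifted Hessian image (lit `opEL_shift`). -/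
theorem curvAdj_curv_fcol_AN_translate (T : Fin (3 + 1) → ℕ) (hT : ∀ i, Lc ^ (j + 1) ∣ T i) (μ κ : Fin (3 + 1)) (y n x : Site (3 + 1)) :
    curvAdj (curv (fcol (AN R j) (translate T (((Lc ^ (j + 1) : ℕ) : ℤ) • y) n) (Sum.inr μ))) κ x
      = curvAdj (curv (colH (AN R j) (Lc ^ (j + 1)) μ y)) κ (x - translate T 0 n) := by
  rw [fcol_AN_translate R j T hT μ y n, opEL_shift]

end Shift

/-! ## §3 The wrapper's (K1) left side on the torus column = the periodised Hessian image -/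

section Torus

variable (T : Fin (3 + 1) → ℕ) [∀ i, NeZero (T i)]

/-- [folklore] **`perF_ff_mulVec_perF_AN_eq_tsum` — THE (K1) LEFT SIDE ON THE TORUS COLUMN OF THE COMPOSITE CHART IS THE FINE-BOND PERIODISATION OF `E″ colN`**:
for every root `ρ`, torus `T` with `Lc^(j+1) ∣ T i`, source `(μ, y)` and torus bond `u`,
`Σ_b (perF T (bhKStepAt 3 ρ Lc 0)) (u♭, b♭)·(perF T (AN R j)) (b♭, (wrapPt T (L•y), inr μ)) = Σ'_n (E″ colN)(u.2, translate T u.1 n)`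
(`perF_comp` at the decaying, `T`-invariant pair (field part of `bhK Lc`, `AN R j`); the field part kills the multiplier summands; `tsum_bhK_inl_inl`; §2; re-indexing). -/
theorem perF_ff_mulVec_perF_AN_eq_tsum (hT : ∀ i, Lc ^ (j + 1) ∣ T i) (ρ : Fin (3 + 1) → ℤ) (μ : Fin (3 + 1)) (y : Site (3 + 1))
    (u : ↥(pbox T) × Fin (3 + 1)) :
    ∑ b : ↥(pbox T) × Fin (3 + 1), perF T (bhKStepAt 3 ρ Lc 0) (u.1, Sum.inl u.2) (b.1, Sum.inl b.2)
        * perF T (AN R j) (b.1, Sum.inl b.2) (wrapPt T (((Lc ^ (j + 1) : ℕ) : ℤ) • y), Sum.inr μ)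
      = ∑' n : Site (3 + 1), curvAdj (curv (colH (AN R j) (Lc ^ (j + 1)) μ y)) u.2 (translate T (u.1 : Site (3 + 1)) n) := by
  obtain ⟨δ, C, hδ, -, hA⟩ := decays_AN R j
  set E : MKer (3 + 1) (Fib 3) := fun x z (a c : Fib 3) => match a, c with
      | Sum.inl κ, Sum.inl l => bhK Lc x z (Sum.inl κ) (Sum.inl l)
      | _, _ => (0 : ℝ) with hE
  set q : Idx T (Fib 3) := (wrapPt T (((Lc ^ (j + 1) : ℕ) : ℤ) • y), Sum.inr μ) with hq
  -- (1) the road's ff block is the field part's; the field part kills the multiplier summands, so the ff sum is a full matrix product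
  have h1 : ∑ b : ↥(pbox T) × Fin (3 + 1), perF T (bhKStepAt 3 ρ Lc 0) (u.1, Sum.inl u.2) (b.1, Sum.inl b.2) * perF T (AN R j) (b.1, Sum.inl b.2) q
      = (perF T E * perF T (AN R j)) (u.1, Sum.inl u.2) q := by
    rw [Matrix.mul_apply, Fintype.sum_prod_type, Fintype.sum_prod_type]
    refine Finset.sum_congr rfl fun x _ => ?_
    rw [Fintype.sum_sum_type]
    simp only [hE, perF_inl_inr_ffPart_eq_zero, zero_mul, Finset.sum_const_zero, add_zero]
    exact Finset.sum_congr rfl fun κ _ => by rw [perF_inl_inl_bhKStepAt_zero_eq ρ T u (x, κ)]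
  -- (2) periodisation is multiplicative on the decaying, `T`-invariant pair
  have h2 : perF T E * perF T (AN R j) = perF T (comp E (AN R j)) :=
    (perF_comp T (hE ▸ decays_ffPart_bhK (Lc := Lc)) hA one_pos hδ (fun m x z a b => AN_translate_invariant R j (M := T) hT m x z a b)).symm
  rw [h1, h2, perF_apply, perZ_apply]
  -- (3) each summand: the field part acts as `E″` on the column sourced at a period-translate of the slot = the shifted Hessian image
  have h3 : ∀ m : Site (3 + 1), comp E (AN R j) (u.1 : Site (3 + 1)) (translate T (q.1 : Site (3 + 1)) m) (Sum.inl u.2) q.2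
      = curvAdj (curv (colH (AN R j) (Lc ^ (j + 1)) μ y)) u.2 (translate T (u.1 : Site (3 + 1)) (quo T (((Lc ^ (j + 1) : ℕ) : ℤ) • y) - m)) := by
    intro m
    rw [hq, wrapPt_coe, translate_wrap_eq, hE, comp_ffPart_bhK_inl_inr, curvAdj_curv_fcol_AN_translate R j T hT]
    congr 1
    funext i; simp only [B4TorusKernel.MultiPeriod.translate_apply, Pi.sub_apply, Pi.zero_apply]; ring
  rw [tsum_congr h3]
  exact (Equiv.subLeft (quo T (((Lc ^ (j + 1) : ℕ) : ℤ) • y))).tsum_eq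
    (fun n => curvAdj (curv (colH (AN R j) (Lc ^ (j + 1)) μ y)) u.2 (translate T (u.1 : Site (3 + 1)) n))

/-- [folklore] **`perF_ff_mulVec_perF_AN_eq_K1_shape` — THE WRAPPER's (K1) ROW, BOTH SIDES, FOR THE TORUS COLUMN OF THE COMPOSITE CHART**: for tori `T i = Lc·T′ i`
(`1 ≤ T′ i`, `Lc^(j+1) ∣ T i`), every root `ρ`, source `(μ, y)`, torus bond `u`:
`Σ_b (perF T (bhKStepAt 3 ρ Lc 0))|ff (u, b)·(perF T (AN R j)) (b♭, (wrapPt T (L•y), inr μ))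
  = −(Lc⁴)^{j+1}·Σ_{κ₁} Σ'_{s₁} (Σ'_n λ′ᴿ_j (κ₁, translate T′ s₁ n))·symLinKerAt (toSite R.r) Lc κ₁ s₁ (u.2, u.1)` (§3 + PART 23). -/
theorem perF_ff_mulVec_perF_AN_eq_K1_shape (T' : Fin (3 + 1) → ℕ) (hTT' : ∀ i, T i = Lc * T' i) (hT' : ∀ i, 1 ≤ T' i)
    (hT : ∀ i, Lc ^ (j + 1) ∣ T i) (ρ : Fin (3 + 1) → ℤ) (μ : Fin (3 + 1)) (y : Site (3 + 1)) (u : ↥(pbox T) × Fin (3 + 1)) :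
    ∑ b : ↥(pbox T) × Fin (3 + 1), perF T (bhKStepAt 3 ρ Lc 0) (u.1, Sum.inl u.2) (b.1, Sum.inl b.2)
        * perF T (AN R j) (b.1, Sum.inl b.2) (wrapPt T (((Lc ^ (j + 1) : ℕ) : ℤ) • y), Sum.inr μ)
      = -((Lc : ℝ) ^ (3 + 1)) ^ (j + 1) * ∑ κ₁ : Fin (3 + 1), ∑' s₁ : Site (3 + 1),
          (∑' n : Site (3 + 1), ∑ ν : Fin (3 + 1), ∑' w : Site (3 + 1),
              (∑ κ' : Fin (3 + 1), ∑' u' : Site (3 + 1),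
                  AN R j u' (((Lc ^ (j + 1) : ℕ) : ℤ) • y) (Sum.inl κ') (Sum.inr μ) * lamCoeffOf (KInv (N := Lc ^ (j + 1)) (d := 3)) (Lc ^ (j + 1)) ν w κ' u')
                * compLinKer (fun _ => symLinKerAt (toSite R.r) Lc) Lc j (κ₁, translate T' s₁ n) (ν, w))
            * symLinKerAt (toSite R.r) Lc κ₁ s₁ (u.2, (u.1 : Site (3 + 1))) := by
  rw [perF_ff_mulVec_perF_AN_eq_tsum R j T hT ρ μ y u, tsum_curvAdj_curv_colH_AN_translate R j T' T hTT' hT' μ u.2 y (u.1 : Site (3 + 1))]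

end Torus

/-! ## §4 On the tower tori of the END wrapper -/

section Tower

/-- [folklore] **`perF_ff_mulVec_perF_AN_eq_K1_shape_tower`** — the same on `T := towerTorus Lc (fine Lc M) m′` (the wrapper's `towerTorus Lc (fine Lc (Mc B)) (n+1)`),
`T′ := towerTorus Lc M m′` (its `Ma (n+1)`), under the displayed divisibility `Lc^(j+1) ∣ T i` (at the wrapper: `j = n+1 = m′`, `T i = Lc^{n+2}·Mc B i` — by `towerTorus_apply`). -/
theorem perF_ff_mulVec_perF_AN_eq_K1_shape_tower (M : Fin (3 + 1) → ℕ) [∀ i, NeZero (M i)] (m' : ℕ)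
    (hT : ∀ i, Lc ^ (j + 1) ∣ towerTorus Lc (fine Lc M) m' i) (ρ : Fin (3 + 1) → ℤ) (μ : Fin (3 + 1)) (y : Site (3 + 1))
    (u : ↥(pbox (towerTorus Lc (fine Lc M) m')) × Fin (3 + 1)) :
    ∑ b : ↥(pbox (towerTorus Lc (fine Lc M) m')) × Fin (3 + 1),
        perF (towerTorus Lc (fine Lc M) m') (bhKStepAt 3 ρ Lc 0) (u.1, Sum.inl u.2) (b.1, Sum.inl b.2)
          * perF (towerTorus Lc (fine Lc M) m') (AN R j) (b.1, Sum.inl b.2)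
              (wrapPt (towerTorus Lc (fine Lc M) m') (((Lc ^ (j + 1) : ℕ) : ℤ) • y), Sum.inr μ)
      = -((Lc : ℝ) ^ (3 + 1)) ^ (j + 1) * ∑ κ₁ : Fin (3 + 1), ∑' s₁ : Site (3 + 1),
          (∑' n : Site (3 + 1), ∑ ν : Fin (3 + 1), ∑' w : Site (3 + 1),
              (∑ κ' : Fin (3 + 1), ∑' u' : Site (3 + 1),
                  AN R j u' (((Lc ^ (j + 1) : ℕ) : ℤ) • y) (Sum.inl κ') (Sum.inr μ) * lamCoeffOf (KInv (N := Lc ^ (j + 1)) (d := 3)) (Lc ^ (j + 1)) ν w κ' u')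
                * compLinKer (fun _ => symLinKerAt (toSite R.r) Lc) Lc j (κ₁, translate (towerTorus Lc M m') s₁ n) (ν, w))
            * symLinKerAt (toSite R.r) Lc κ₁ s₁ (u.2, (u.1 : Site (3 + 1))) :=
  perF_ff_mulVec_perF_AN_eq_K1_shape R j (towerTorus Lc (fine Lc M) m') (towerTorus Lc M m') (towerTorus_fine_apply_eq M m')
    (fun i => one_le_of_neZero (towerTorus Lc M m' i)) hT ρ μ y u

omit [NeZero Lc] in
/-- [folklore] the divisibility letter at the wrapper's indices: `Lc^(m′+1) ∣ towerTorus Lc (fine Lc M) m′ i` (`= Lc^{m′}·(Lc·M i)`; the `fine` instance of road FP's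
`KernelPeriodisationFibHessKerTower.pow_succ_dvd_towerTorus` — not imported here —, cf. PART 11 `NVertexSectorsPeriodised.dvd_towerTorus_fine` at `m′ ≥ 1`). -/
theorem pow_dvd_towerTorus_fine (M : Fin (3 + 1) → ℕ) (m' : ℕ) (i : Fin (3 + 1)) : Lc ^ (m' + 1) ∣ towerTorus Lc (fine Lc M) m' i := by
  rw [towerTorus_apply]
  exact ⟨M i, by simp only [fine]; ring⟩

end Tower

end Summit.QuantumFields.BalabanUV.Beta.NVertexColumnK1RowTorus

end
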